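import Literature.Probability.Percolation.CLE6SubseqLimit
import Literature.Probability.Distributions.WeakConvergenceCoupling
import Literature.Probability.Distributions.FiniteRangeCouplingLift
import HarnessLib

/-!
# The Camia–Newman convergence in coupling form

Topic `Literature/Probability/Percolation` (proofs only; no definitions, no named facts).
Companion to `CLE6.lean` / `CLE6SubseqLimit.lean` and to `FullPlaneCNL.lean`. The Camia–Newman
theorem is stated in the tree as convergence in law (`TendstoLaw`, equivalently weak convergence
of `triLoopLaw D δ` on the Aizenman–Burchard space `LoopSpace ℂ`,
`tendstoLaw_iff_tendsto_triLoopLaw`; named fact `exists_isCNLFamily_tendsto`), whereas the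
full-plane loop law `exists_isFullPlaneCNLLaw` is written in DKKMO's coupling distance `d_CN`
(`LoopConfig.cnLawEDist`: couplings realised on the base probability spaces with a small
exceptional event). This file provides the passage, for every (subsequential or full) limit `P'`
of the loop laws in a Jordan domain `D`:

* `finite_range_triLoopCollection` — at a fixed mesh the loop collection takes finitely many
  values (it factors through the sub-configurations of the finite mesh of `D`,
  `triLoopCollection_inter_triMeshVertices`);
* `exists_isCompact_compl_le_of_tendsto` — **limits are tight**: `P'(Kᶜ) ≤ η` for some compact
  `K` (Aizenman–Burchard tightness of the laws with `δ ∈ (0, 1]`, `isTightMeasureSet_triLoopLaw`,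
  transferred by the closed-set portmanteau inequality `le_measure_of_isClosed_of_tendsto`);
* `eventually_exists_coupling_loopSpace_of_tendsto` — eventually along the limit filter there is
  a coupling of the law of `triLoopCollection D δ` and `P'` with `π{edist ≥ η} ≤ 3η`
  (`WeakConvergenceCoupling.exists_coupling_of_tendsto_of_le_compact`);
* `eventually_exists_coupling_of_tendsto`, `eventually_exists_coupling_of_tendstoLaw` — the same
  **realised on the percolation space**: a probability measure `T` on
  `SiteConfig (Site 2) × LoopSpace ℂ` with marginals `P_{1/2}` and `P'` and
  `T{(ω, L) | edist (triLoopCollection D δ ω, L) ≥ η} ≤ 3η` (lift along the finitely-valued map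
  `triLoopCollection D δ`, `FiniteRangeCouplingLift.exists_coupling_lift_of_finite_range`, in its
  outer-measure form: closed subsets of `LoopSpace ℂ × LoopSpace ℂ` need not be
  product-measurable).

## References

* F. Camia, C. M. Newman, Comm. Math. Phys. 268 (2006) 1–38, Thm 5 and §6; MSRI Publ. 55
  (2008), §5 [CamiaNewman2006] [CamiaNewman2008].
* M. Aizenman, A. Burchard, Duke Math. J. 99 (1999), Thm 1.2 [AizenmanBurchardDuke1999].
* P. Billingsley, *Convergence of Probability Measures*, 2nd ed. (1999), Thm 2.1, §1.5
  [Billingsley1999].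
* R. M. Dudley, *Real Analysis and Probability* (2002), §11.6 (couplings and the Prokhorov
  metric).
-/

noncomputable section

namespace Literature.Probability.Percolation

open RandomPlanarGeometry LatticeModels Literature.Probability.Distributions MeasureTheory Filter Set Metric
open scoped ENNReal _root_.Topology

variable {D : JordanDomain}

/-- Restricting the configuration to the mesh of `D` does not change the loop collection (it is
defined through the restricted configuration). [folklore] -/
theorem triLoopCollection_inter_triMeshVertices (D : JordanDomain) (δ : ℝ) (ω : SiteConfig (Site 2)) :
    triLoopCollection D δ (ω ∩ triMeshVertices D.carrier δ) = triLoopCollection D δ ω := by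
  simp only [triLoopCollection, Set.inter_assoc, Set.inter_self]

/-- **At a fixed mesh the loop collection takes finitely many values** (it factors through the
finitely many sub-configurations of the finite mesh `triMeshVertices D δ`). [folklore] -/
theorem finite_range_triLoopCollection (D : JordanDomain) {δ : ℝ} (hδ : 0 < δ) :
    (Set.range (triLoopCollection D δ)).Finite := by
  have hfin : {A : Set (Site 2) | A ⊆ triMeshVertices D.carrier δ}.Finite :=
    (triMeshVertices_finite_holds D.isBounded hδ).finite_subsets
  refine (hfin.image fun A ↦ triLoopCollection D δ A).subset ?_
  rintro _ ⟨ω, rfl⟩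
  exact ⟨ω ∩ triMeshVertices D.carrier δ, Set.inter_subset_right, triLoopCollection_inter_triMeshVertices D δ ω⟩

/-- **Subsequential limits of the loop laws are tight**: a limit `P'` of `triLoopLaw D` along a
non-trivial filter finer than `𝓝[>] 0` gives, for every `η > 0`, mass `≤ η` to the complement of
some compact set of loop collections (Aizenman–Burchard tightness `isTightMeasureSet_triLoopLaw` of
the laws with `δ ∈ (0, 1]`, transferred to the limit by the closed-set portmanteau inequality
`le_measure_of_isClosed_of_tendsto`). [folklore] -/
theorem exists_isCompact_compl_le_of_tendsto {l : Filter ℝ} [l.NeBot] (hl : l ≤ 𝓝[>] 0)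
    {P' : ProbabilityMeasure (LoopSpace ℂ)} (h : Tendsto (triLoopLaw D) l (𝓝 P')) {η : ℝ≥0∞} (hη : 0 < η) :
    ∃ K : Set (LoopSpace ℂ), IsCompact K ∧ (P' : Measure (LoopSpace ℂ)) Kᶜ ≤ η := by
  obtain ⟨K, hK, hKμ⟩ :=
    (isTightMeasureSet_iff_exists_isCompact_measure_compl_le.1 (isTightMeasureSet_triLoopLaw D)) η hη
  have hcl : IsClosed K := hK.isClosed
  refine ⟨K, hK, ?_⟩
  have h1 : 1 - η ≤ (P' : Measure (LoopSpace ℂ)) K := by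
    refine le_measure_of_isClosed_of_tendsto hl h hcl ?_
    filter_upwards [Ioc_mem_nhdsGT one_pos] with δ hδ
    have hμ : ((triLoopLaw D δ : ProbabilityMeasure (LoopSpace ℂ)) : Measure (LoopSpace ℂ)) Kᶜ ≤ η :=
      hKμ _ ⟨triLoopLaw D δ, ⟨δ, hδ, rfl⟩, rfl⟩
    rw [triLoopLaw_apply hδ.1 hcl.measurableSet.compl] at hμ
    have hmeas : MeasurableSet {ω : SiteConfig (Site 2) | triLoopCollection D δ ω ∈ K} :=
      measurable_triLoopCollection_holds D hδ.1 hcl.measurableSet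
    have hc : triSitePercolation half {ω : SiteConfig (Site 2) | triLoopCollection D δ ω ∈ K}ᶜ ≤ η := hμ
    rw [prob_compl_eq_one_sub hmeas] at hc
    exact tsub_le_iff_right.2 (by
      calc (1 : ℝ≥0∞) ≤ 1 - triSitePercolation half {ω | triLoopCollection D δ ω ∈ K} +
            triSitePercolation half {ω | triLoopCollection D δ ω ∈ K} := le_tsub_add
        _ ≤ η + triSitePercolation half {ω | triLoopCollection D δ ω ∈ K} := add_le_add_left hc _
        _ = triSitePercolation half {ω | triLoopCollection D δ ω ∈ K} + η := add_comm _ _)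
  rw [prob_compl_eq_one_sub hcl.measurableSet]
  exact tsub_le_iff_right.2 (by
    calc (1 : ℝ≥0∞) ≤ 1 - η + η := le_tsub_add
      _ ≤ (P' : Measure (LoopSpace ℂ)) K + η := add_le_add_left h1 _
      _ = η + (P' : Measure (LoopSpace ℂ)) K := add_comm _ _)

/-- **Coupling form of the convergence of the loop laws, on the loop space.** If
`triLoopLaw D δ → P'` along a non-trivial filter `l` finer than `𝓝[>] 0` (e.g. the full limit
of `exists_isCNLFamily_tendsto` through `tendstoLaw_iff_tendsto_triLoopLaw`, or a subsequential
limit), then for every `η > 0`, eventually along `l` there is a coupling `π` of the law of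
`triLoopCollection D δ` and `P'` under which the two collections are at Hausdorff edistance
`≥ η` with probability `≤ 3η` (`WeakConvergenceCoupling.exists_coupling_of_tendsto_of_le_compact`
with the tightness of the limit). [folklore] -/
theorem eventually_exists_coupling_loopSpace_of_tendsto {l : Filter ℝ} [l.NeBot] (hl : l ≤ 𝓝[>] 0)
    {P' : ProbabilityMeasure (LoopSpace ℂ)} (h : Tendsto (triLoopLaw D) l (𝓝 P')) {η : ℝ} (hη : 0 < η) :
    ∀ᶠ δ in l, ∃ π : Measure (LoopSpace ℂ × LoopSpace ℂ), IsProbabilityMeasure π ∧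
      π.map Prod.fst = ((triLoopLaw D δ : ProbabilityMeasure (LoopSpace ℂ)) : Measure (LoopSpace ℂ)) ∧
      π.map Prod.snd = (P' : Measure (LoopSpace ℂ)) ∧
      π {p | ENNReal.ofReal η ≤ edist p.1 p.2} ≤ 3 * ENNReal.ofReal η := by
  obtain ⟨K, hK, hKc⟩ := exists_isCompact_compl_le_of_tendsto hl h (ENNReal.ofReal_pos.2 hη)
  exact exists_coupling_of_tendsto_of_le_compact h hη hK hKc

/-- **Coupling form of the convergence of the loop laws, on the percolation space.** Under the
same hypothesis, for every `η > 0`, eventually along `l` there is a coupling `T` of the critical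
site percolation measure `P_{1/2}` and `P'` — a probability measure on
`SiteConfig (Site 2) × LoopSpace ℂ` with these marginals — under which
`edist (triLoopCollection D δ ω, L) ≥ η` has probability `≤ 3η` (lift of the loop-space
coupling along the finitely-valued map `triLoopCollection D δ`,
`FiniteRangeCouplingLift.exists_coupling_lift_of_finite_range`). This is the form consumed by
the coupling distance `LoopConfig.cnLawEDist` (couplings realised on the base spaces). [folklore] -/
theorem eventually_exists_coupling_of_tendsto {l : Filter ℝ} [l.NeBot] (hl : l ≤ 𝓝[>] 0)
    {P' : ProbabilityMeasure (LoopSpace ℂ)} (h : Tendsto (triLoopLaw D) l (𝓝 P')) {η : ℝ} (hη : 0 < η) :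
    ∀ᶠ δ in l, ∃ T : Measure (SiteConfig (Site 2) × LoopSpace ℂ), IsProbabilityMeasure T ∧
      T.map Prod.fst = triSitePercolation half ∧ T.map Prod.snd = (P' : Measure (LoopSpace ℂ)) ∧
      T {p | ENNReal.ofReal η ≤ edist (triLoopCollection D δ p.1) p.2} ≤ 3 * ENNReal.ofReal η := by
  filter_upwards [eventually_exists_coupling_loopSpace_of_tendsto hl h hη, hl eventually_nhdsGT_pos]
    with δ ⟨π, hπ, h1, h2, h3⟩ hδ
  have hf : Measurable (triLoopCollection D δ) := measurable_triLoopCollection_holds D hδ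
  have h1' : π.map Prod.fst = (triSitePercolation half).map (triLoopCollection D δ) := by
    rw [h1, coe_triLoopLaw hδ]
  obtain ⟨T, hT, hT1, hT2, -, hTE⟩ :=
    exists_coupling_lift_of_finite_range hf (finite_range_triLoopCollection D hδ) h1'
  refine ⟨T, hT, hT1, hT2.trans h2, ?_⟩
  calc T {p | ENNReal.ofReal η ≤ edist (triLoopCollection D δ p.1) p.2}
      = T {p | (triLoopCollection D δ p.1, p.2) ∈ {q : LoopSpace ℂ × LoopSpace ℂ | ENNReal.ofReal η ≤ edist q.1 q.2}} := rfl
    _ ≤ π {q : LoopSpace ℂ × LoopSpace ℂ | ENNReal.ofReal η ≤ edist q.1 q.2} := hTE _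
    _ ≤ 3 * ENNReal.ofReal η := h3

/-- The same for the full limit of `exists_isCNLFamily_tendsto`-type statements (`TendstoLaw`
along `𝓝[>] 0` towards a probability law `P'`). [folklore] -/
theorem eventually_exists_coupling_of_tendstoLaw {P' : Measure (LoopSpace ℂ)} [IsProbabilityMeasure P']
    (h : TendstoLaw (Ωδ := fun _ ↦ SiteConfig (Site 2)) (fun δ ↦ triLoopCollection D δ)
      (fun _ ↦ triSitePercolation half) id P') {η : ℝ} (hη : 0 < η) :
    ∀ᶠ δ in 𝓝[>] (0 : ℝ), ∃ T : Measure (SiteConfig (Site 2) × LoopSpace ℂ), IsProbabilityMeasure T ∧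
      T.map Prod.fst = triSitePercolation half ∧ T.map Prod.snd = P' ∧
      T {p | ENNReal.ofReal η ≤ edist (triLoopCollection D δ p.1) p.2} ≤ 3 * ENNReal.ofReal η :=
  eventually_exists_coupling_of_tendsto le_rfl ((tendstoLaw_iff_tendsto_triLoopLaw D).1 h) hη

end Literature.Probability.Percolation

end
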